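import Literature.AlgebraicGeometry.Resolution.ValuationOverrings
import Literature.AlgebraicGeometry.Resolution.ValuationAlgebraicExtension
import Mathlib.FieldTheory.Fixed
import HarnessLib

/-!
# The least coarsening with a larger decomposition group (Kuhlmann 2011, §4)

Topic: `Literature/AlgebraicGeometry/Resolution` (valued function fields). Second step of the
proof (files `ValuationOverrings.lean`, `ValuationAlgebraicExtension.lean`, this file,
`DecompositionFieldApprox.lean`) that the decomposition field of a valued finite Galois
extension is approximated to first order by the base field (F.-V. Kuhlmann, *Approximation of
elements in henselizations*, Manuscripta Math. 136 (2011), Thm. 1.1), whence the henselization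
is an immediate extension (Kuhlmann 2010, Lemma 2.2).

Zariski–Samuel (and Kuhlmann, loc. cit., §4) prove that the decomposition field `Z` of
`(N|K, v)` is immediate over `K` by an induction on the number of extensions of `v` to `N`,
passing to a suitable COARSENING `w` of `v` whose extensions are fewer and whose residual
extensions are pairwise independent. We render the choice of `w` group-theoretically: for a
finite group `G` of automorphisms of the field `N` and a valuation subring `W` whose
decomposition group `D(W) = Stab_G(W)` is not all of `G`,

* `exists_coarsening_stabilizer_lt` — there is a coarsening `W < W'` with `D(W) < D(W')` and
  the KEY PROPERTY: every valuation ring containing `W` and a conjugate `τ • W ≠ W` contains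
  `W'`. (`W'` is the intersection of all coarsenings `U ⊇ W` with `D(U) ≠ D(W)`; these form a
  chain, their decomposition groups take a least value `H' > D(W)` by finiteness of `G`, and
  `H'` stabilises `W'`.) PROVED.

and, for `N | K` finite Galois (`G = Gal(N|K)`), `W'` stabilised by a subgroup `G'`:

* `exists_mem_inter_not_mem` — the join property needed by the large-elements lemma: for a
  conjugate `V = σ • W ≠ W` (`σ ∈ G'`) and a valuation ring `U` with `V ≤ U < W'`, the ring
  `W ∩ ⋂ {other conjugates}` is not contained in `U` (by `exists_le_of_forall_mem` and the key
  property). PROVED.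
* `exists_valuation_lt_one_forall_lt_valuation_smul` — the simultaneous "small at `W`, large at
  the conjugates" element: for finitely many `σ ∈ G'` with `σ • W ≠ W` and `d ∈ W'`, `d ≠ 0`,
  there is `x` with `|x|_W < 1` and `|σ⁻¹ x|_W > |d|_W` for all these `σ`. PROVED
  (`exists_mem_not_mem_div_not_mem` in each `W ∩ ⋂ {other conjugates}`, summed and multiplied
  by a `W'`-unit `π ∈ 𝔪_W`).

## Sources

* F.-V. Kuhlmann, *Approximation of elements in henselizations*, Manuscripta Math. 136 (2011)
  461–474 = arXiv:1003.5674, §4 (proof of Thm. 1.1 after Zariski–Samuel). [Kuhlmann2011]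
* O. Zariski, P. Samuel, *Commutative Algebra* II (1960), Ch. VI §7 and §12. [ZariskiSamuel1960]

## Rendering notes

* Everything is stated with Mathlib's pointwise action `σ • W` on `ValuationSubring N` and
  `MulAction.stabilizer`; for `G = N ≃ₐ[K] N` the stabiliser is
  `ValuationSubring.decompositionSubgroup K W` by definition.
* No definition is introduced: `W'` is produced existentially with the properties used later.
-/

noncomputable section

open scoped Pointwise

namespace Literature.AlgebraicGeometry.Resolution

universe u

variable {N : Type u} [Field N]

/-! ### The least coarsening with a larger stabiliser -/

section Coarsening

variable {G : Type*} [Group G] [Finite G] [MulSemiringAction G N]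

omit [Finite G] in
/-- Every automorphism stabilises the trivial valuation ring `⊤ = N`. [folklore] -/
theorem smul_top_valuationSubring (g : G) : g • (⊤ : ValuationSubring N) = ⊤ :=
  ValuationSubring.ext _ _ fun x =>
    ⟨fun _ => ValuationSubring.mem_top x, fun _ =>
      ValuationSubring.mem_pointwise_smul_iff_inv_smul_mem.mpr (ValuationSubring.mem_top _)⟩

/-- **The least coarsening with a larger decomposition group.** Let the finite group `G` act on
the field `N` and let `W` be a valuation subring whose stabiliser `D(W)` is not all of `G`.
Then there is a coarsening `W'` of `W`, `W < W'`, with `D(W) < D(W')`, such that every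
valuation subring `U ⊇ W` containing a conjugate `τ • W ≠ W` contains `W'` (equivalently: for
`τ ∈ D(W') ∖ D(W)` the join of `W` and `τ • W` is exactly `W'`, i.e. the residue rings of `W`
and `τ • W` in the residue field of `W'` are independent — the situation to which
Zariski–Samuel and Kuhlmann 2011, §4, reduce the proof that the decomposition field is an
immediate extension). [cite: Kuhlmann2011, Section 4] -/
theorem exists_coarsening_stabilizer_lt (W : ValuationSubring N)
    (hW : MulAction.stabilizer G W ≠ ⊤) :
    ∃ W' : ValuationSubring N, W ≤ W' ∧ W ≠ W' ∧
      MulAction.stabilizer G W < MulAction.stabilizer G W' ∧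
      ∀ τ : G, τ • W ≠ W → ∀ U : ValuationSubring N, W ≤ U → τ • W ≤ U → W' ≤ U := by
  classical
  set H := MulAction.stabilizer G W with hH_def
  -- the coarsenings with a different stabiliser
  let T : Set (ValuationSubring N) := {U | W ≤ U ∧ MulAction.stabilizer G U ≠ H}
  have htopstab : MulAction.stabilizer G (⊤ : ValuationSubring N) = ⊤ :=
    eq_top_iff.mpr fun g _ => MulAction.mem_stabilizer_iff.mpr (smul_top_valuationSubring g)
  have htop : (⊤ : ValuationSubring N) ∈ T := ⟨le_top, by rw [htopstab]; exact fun h => hW h.symm⟩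
  -- their intersection `W'`
  let R : Subring N := ⨅ U ∈ T, (U : ValuationSubring N).toSubring
  have hR : ∀ x : N, x ∈ R ↔ ∀ U ∈ T, x ∈ U := by
    intro x
    simp only [R, Subring.mem_iInf]
    exact ⟨fun h U hU => h U hU, fun h U hU => h U hU⟩
  have hRval : ∀ x : N, x ∈ R ∨ x⁻¹ ∈ R := by
    intro x
    by_cases h : ∀ U ∈ T, x ∈ U
    · exact Or.inl ((hR x).mpr h)
    · push Not at h
      obtain ⟨U₀, hU₀T, hxU₀⟩ := h
      refine Or.inr ((hR _).mpr fun U hUT => ?_)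
      rcases overring_le_or_ge hU₀T.1 hUT.1 with hle | hle
      · exact hle ((U₀.mem_or_inv_mem x).resolve_left hxU₀)
      · exact (U.mem_or_inv_mem x).resolve_left fun hxU => hxU₀ (hle hxU)
  let W' : ValuationSubring N := ValuationSubring.ofSubring R hRval
  have hW' : ∀ x : N, x ∈ W' ↔ ∀ U ∈ T, x ∈ U := fun x =>
    (ValuationSubring.mem_ofSubring R hRval x).trans (hR x)
  have hW'le : ∀ U ∈ T, W' ≤ U := fun U hU x hx => (hW' x).mp hx U hU
  -- stabilisers grow along coarsenings
  have hmono : ∀ {U₁ U₂ : ValuationSubring N}, U₁ ≤ U₂ →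
      MulAction.stabilizer G U₁ ≤ MulAction.stabilizer G U₂ :=
    fun h g hg => MulAction.mem_stabilizer_iff.mpr
      (mem_stabilizer_of_le (isOfFinOrder_of_finite g) h (MulAction.mem_stabilizer_iff.mp hg))
  -- a member `U₀` of `T` with stabiliser of least cardinality
  have hex : ∃ n, ∃ U ∈ T, Nat.card (MulAction.stabilizer G U) = n := ⟨_, ⊤, htop, rfl⟩
  obtain ⟨U₀, hU₀T, hU₀n⟩ := Nat.find_spec hex
  have hmin : ∀ U ∈ T,
      Nat.card (MulAction.stabilizer G U₀) ≤ Nat.card (MulAction.stabilizer G U) := by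
    intro U hU
    rw [hU₀n]
    exact Nat.find_min' hex ⟨U, hU, rfl⟩
  set H' := MulAction.stabilizer G U₀ with hH'_def
  -- `H'` stabilises every member of `T`, hence `W'`
  have hA : ∀ U ∈ T, H' ≤ MulAction.stabilizer G U := by
    intro U hU
    rcases overring_le_or_ge hU₀T.1 hU.1 with hle | hle
    · exact hmono hle
    · rw [hH'_def, ← Subgroup.eq_of_le_of_card_ge (hmono hle) (hmin U hU)]
  have hB : H' ≤ MulAction.stabilizer G W' := by
    intro g hg
    refine MulAction.mem_stabilizer_iff.mpr (ValuationSubring.ext _ _ fun x => ?_)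
    rw [ValuationSubring.mem_pointwise_smul_iff_inv_smul_mem, hW', hW']
    refine forall₂_congr fun U hU => ?_
    have hgU : g • U = U := MulAction.mem_stabilizer_iff.mp (hA U hU hg)
    rw [← ValuationSubring.mem_pointwise_smul_iff_inv_smul_mem, hgU]
  have hHH' : H < H' := lt_of_le_of_ne (hmono hU₀T.1) (fun h => hU₀T.2 h.symm)
  have hlt : H < MulAction.stabilizer G W' := lt_of_lt_of_le hHH' hB
  have hWW' : W ≤ W' := fun x hx => (hW' x).mpr fun U hU => hU.1 hx
  refine ⟨W', hWW', fun h => ?_, hlt, fun τ hτ U hWU hτU => ?_⟩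
  · rw [← h] at hlt
    exact lt_irrefl _ hlt
  · -- the key property
    have hτU' : τ • U = U := smul_eq_of_le_of_smul_le (isOfFinOrder_of_finite τ) hWU hτU
    refine hW'le U ⟨hWU, fun heq => hτ ?_⟩
    have : τ ∈ MulAction.stabilizer G U := MulAction.mem_stabilizer_iff.mpr hτU'
    rw [heq] at this
    exact MulAction.mem_stabilizer_iff.mp this

end Coarsening

/-! ### Valuations of a conjugate valuation ring -/

section Conjugate

variable {G : Type*} [Group G] [MulSemiringAction G N]

/-- The valuation of the conjugate ring `σ • W` compares `y, y'` as the valuation of `W`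
compares `σ⁻¹ y, σ⁻¹ y'`. [folklore] -/
theorem smul_valuation_le_iff (σ : G) (W : ValuationSubring N) (y y' : N) :
    (σ • W).valuation y ≤ (σ • W).valuation y' ↔
      W.valuation (σ⁻¹ • y) ≤ W.valuation (σ⁻¹ • y') := by
  rw [ValuationSubring.valuation_le_iff, ValuationSubring.valuation_le_iff]
  constructor
  · rintro ⟨a, ha⟩
    refine ⟨⟨σ⁻¹ • (a : N), ValuationSubring.mem_pointwise_smul_iff_inv_smul_mem.mp a.2⟩, ?_⟩
    change σ⁻¹ • (a : N) * σ⁻¹ • y' = σ⁻¹ • y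
    rw [← smul_mul', ha]
  · rintro ⟨a, ha⟩
    refine ⟨⟨σ • (a : N), ValuationSubring.smul_mem_pointwise_smul _ _ _ a.2⟩, ?_⟩
    change σ • (a : N) * y' = y
    have := congrArg (fun t => σ • t) ha
    simpa only [smul_mul', smul_inv_smul] using this

/-- Strict version of `smul_valuation_le_iff`. [folklore] -/
theorem smul_valuation_lt_iff (σ : G) (W : ValuationSubring N) (y y' : N) :
    (σ • W).valuation y < (σ • W).valuation y' ↔
      W.valuation (σ⁻¹ • y) < W.valuation (σ⁻¹ • y') := by
  rw [lt_iff_not_ge, lt_iff_not_ge, smul_valuation_le_iff]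

end Conjugate

/-! ### The join property and the small/large element, for a finite Galois extension -/

section Galois

variable {K : Type u} [Field K] [Algebra K N] [FiniteDimensional K N]

omit [FiniteDimensional K N] in
/-- A `K`-automorphism does not change the valuation ring induced on `K`:
`(σ • W) ∩ K = W ∩ K`. [folklore] -/
theorem comap_algebraMap_smul (σ : N ≃ₐ[K] N) (W : ValuationSubring N) :
    (σ • W).comap (algebraMap K N) = W.comap (algebraMap K N) := by
  ext x
  simp only [ValuationSubring.mem_comap, ValuationSubring.mem_pointwise_smul_iff_inv_smul_mem,
    AlgEquiv.smul_def, AlgEquiv.commutes]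

/-- **The join property.** Let `W ≤ W'` be valuation subrings of the finite extension `N` of `K`,
`G'` a subgroup of `Gal(N|K)` stabilising `W'`, and assume the key property of
`exists_coarsening_stabilizer_lt` (every valuation ring containing `W` and a conjugate
`τ • W ≠ W` contains `W'`). For finitely many `σ ∈ G'` moving `W` and a conjugate `V = σ • W`
among them: the intersection of `W` with the OTHER conjugates is contained in no valuation ring
`U` with `V ≤ U ≤ W'`, `U ≠ W'` (by `exists_le_of_forall_mem`, such a `U` would contain `W` or
another conjugate, hence `W'`). [cite: Kuhlmann2011, Section 4] -/
theorem exists_mem_inter_not_mem (W W' : ValuationSubring N) (G' : Subgroup (N ≃ₐ[K] N))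
    (hG' : ∀ σ ∈ G', σ • W' = W')
    (hkey : ∀ τ : N ≃ₐ[K] N, τ • W ≠ W → ∀ U : ValuationSubring N, W ≤ U → τ • W ≤ U → W' ≤ U)
    (S : Finset (N ≃ₐ[K] N)) (hS : ∀ σ ∈ S, σ ∈ G' ∧ σ • W ≠ W)
    {V : ValuationSubring N} (hV : ∃ σ ∈ S, σ • W = V)
    (U : ValuationSubring N) (hVU : V ≤ U) (hUW' : U ≤ W') (hUne : U ≠ W') :
    ∃ r : N, (r ∈ W ∧ ∀ σ' ∈ S, σ' • W ≠ V → r ∈ σ' • W) ∧ r ∉ U := by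
  classical
  by_contra hcon
  push Not at hcon
  let F : Finset (ValuationSubring N) := insert W ((S.image fun σ => σ • W).erase V)
  have hFO : ∀ V'' ∈ F, V''.comap (algebraMap K N) = W.comap (algebraMap K N) := by
    intro V'' hV''
    rcases Finset.mem_insert.mp hV'' with rfl | h
    · rfl
    · obtain ⟨σ, -, rfl⟩ := Finset.mem_image.mp (Finset.mem_of_mem_erase h)
      exact comap_algebraMap_smul σ _
  haveI : Algebra.IsAlgebraic K N := Algebra.IsAlgebraic.of_finite K N
  obtain ⟨V₁, hV₁F, hV₁U⟩ := exists_le_of_forall_mem (W.comap (algebraMap K N)) F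
    ⟨W, Finset.mem_insert_self _ _⟩ hFO U fun x hx =>
      hcon x ⟨hx W (Finset.mem_insert_self _ _), fun σ' hσ' hne' =>
        hx (σ' • W) (Finset.mem_insert_of_mem (Finset.mem_erase.mpr
          ⟨hne', Finset.mem_image.mpr ⟨σ', hσ', rfl⟩⟩))⟩
  obtain ⟨σ, hσS, rfl⟩ := hV
  apply hUne (le_antisymm hUW' ?_)
  rcases Finset.mem_insert.mp hV₁F with rfl | h1
  · exact hkey σ (hS σ hσS).2 U hV₁U hVU
  · obtain ⟨hne1, h1'⟩ := Finset.mem_erase.mp h1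
    obtain ⟨σ₁, hσ₁S, rfl⟩ := Finset.mem_image.mp h1'
    have hτ : (σ₁⁻¹ * σ) • W ≠ W := by
      intro h
      apply hne1
      rw [mul_smul, inv_smul_eq_iff] at h
      exact h.symm
    have h2 : W ≤ σ₁⁻¹ • U :=
      ValuationSubring.subset_pointwise_smul_iff.mpr (by rw [inv_inv]; exact hV₁U)
    have h3 : (σ₁⁻¹ * σ) • W ≤ σ₁⁻¹ • U := by
      rw [mul_smul]
      exact ValuationSubring.pointwise_smul_le_pointwise_smul_iff.mpr hVU
    have h4 := hkey _ hτ _ h2 h3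
    have h5 : σ₁ • W' ≤ U := by
      have := (ValuationSubring.pointwise_smul_le_pointwise_smul_iff (g := σ₁)).mpr h4
      rwa [smul_inv_smul] at this
    rwa [hG' σ₁ (hS σ₁ hσ₁S).1] at h5

/-- **Small at `W`, large at the conjugates.** In the situation of `exists_mem_inter_not_mem`
with `W ≠ W'`, for finitely many `σ ∈ G'` moving `W` and any `d ∈ W'`, `d ≠ 0`, there is
`x ∈ 𝔪_W` with `|σ⁻¹ x|_W > |d|_W` for all these `σ` — i.e. `x` is small at `W` and as large
as prescribed (within the units of `W'`) at every conjugate `σ • W`. Proof: for each conjugate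
`V` the large-elements lemma `exists_mem_not_mem_div_not_mem` in the ring
`W ∩ ⋂ {other conjugates}` (join property above) gives `x_V`, large at `V` and `≤ 1` at the
other conjugates; take `x = π Σ_V x_V` with `π ∈ 𝔪_W` a unit of `W'`. This is the substitute,
valid for dependent valuations, of the approximation theorem used by Zariski–Samuel and
Kuhlmann 2011, §4 (Lemma 4.1) in the independent case. [cite: Kuhlmann2011, Lemma 4.1] -/
theorem exists_valuation_lt_one_forall_lt_valuation_smul {W W' : ValuationSubring N}
    (hWW' : W ≤ W') (hne : W ≠ W') (G' : Subgroup (N ≃ₐ[K] N)) (hG' : ∀ σ ∈ G', σ • W' = W')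
    (hkey : ∀ τ : N ≃ₐ[K] N, τ • W ≠ W → ∀ U : ValuationSubring N, W ≤ U → τ • W ≤ U → W' ≤ U)
    (S : Finset (N ≃ₐ[K] N)) (hS : ∀ σ ∈ S, σ ∈ G' ∧ σ • W ≠ W) {d : N} (hd : d ∈ W')
    (hd0 : d ≠ 0) :
    ∃ x : N, W.valuation x < 1 ∧ ∀ σ ∈ S, W.valuation d < W.valuation (σ⁻¹ • x) := by
  classical
  -- a unit `π⁻¹ = z` of `W'` with `π ∈ 𝔪_W`
  obtain ⟨z, hzW', hzW⟩ := SetLike.exists_of_lt (lt_of_le_of_ne hWW' hne)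
  have hz0 : z ≠ 0 := fun h => hzW (h ▸ W.zero_mem)
  have hπW : W.valuation z⁻¹ < 1 := by
    have : 1 < W.valuation z := lt_of_not_ge fun h => hzW ((W.valuation_le_one_iff z).mp h)
    exact (Valuation.one_lt_val_iff _ hz0).mp this
  have hπ0 : z⁻¹ ≠ 0 := inv_ne_zero hz0
  -- the conjugates `𝓥`
  let 𝓥 : Finset (ValuationSubring N) := S.image fun σ => σ • W
  have h𝓥W' : ∀ V ∈ 𝓥, V ≤ W' ∧ V ≠ W' := by
    intro V hV
    obtain ⟨σ, hσ, rfl⟩ := Finset.mem_image.mp hV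
    have hσW' := hG' σ (hS σ hσ).1
    refine ⟨?_, fun h => hne ?_⟩
    · rw [← hσW']
      exact ValuationSubring.pointwise_smul_le_pointwise_smul_iff.mpr hWW'
    · rw [← hσW'] at h
      exact smul_left_cancel σ h
  -- for each conjugate, the `σ ∈ S` giving it with `|σ d|` largest
  have hmax : ∀ V ∈ 𝓥, ∃ σ ∈ S, σ • W = V ∧
      ∀ σ' ∈ S, σ' • W = V → V.valuation (σ' • d) ≤ V.valuation (σ • d) := by
    intro V hV
    have hne' : (S.filter fun σ => σ • W = V).Nonempty := by
      obtain ⟨σ, hσ, rfl⟩ := Finset.mem_image.mp hV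
      exact ⟨σ, Finset.mem_filter.mpr ⟨hσ, rfl⟩⟩
    obtain ⟨σ, hσ, hmaxσ⟩ := Finset.exists_max_image _ (fun σ => V.valuation (σ • d)) hne'
    obtain ⟨hσS, hσV⟩ := Finset.mem_filter.mp hσ
    exact ⟨σ, hσS, hσV, fun σ' hσ' hσ'V => hmaxσ σ' (Finset.mem_filter.mpr ⟨hσ', hσ'V⟩)⟩
  choose! σV hσVS hσVW hσVmax using hmax
  -- the large elements `x_V ∈ W ∩ ⋂ {other conjugates}`
  have hlarge : ∀ V ∈ 𝓥, ∃ x : N, (x ∈ W ∧ ∀ V' ∈ 𝓥, V' ≠ V → x ∈ V') ∧ x ∉ V ∧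
      x / (σV V • d / z⁻¹) ∉ V := by
    intro V hV
    let R : Subring N := W.toSubring ⊓ ⨅ V' ∈ 𝓥.erase V, (V' : ValuationSubring N).toSubring
    have hR : ∀ x, x ∈ R ↔ x ∈ W ∧ ∀ V' ∈ 𝓥, V' ≠ V → x ∈ V' := by
      intro x
      simp only [R, Subring.mem_inf, Subring.mem_iInf, Finset.mem_erase,
        ValuationSubring.mem_toSubring]
      exact ⟨fun h => ⟨h.1, fun V' hV' hne' => h.2 V' ⟨hne', hV'⟩⟩,
        fun h => ⟨h.1, fun V' hV' => h.2 V' hV'.2 hV'.1⟩⟩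
    have hjoin : ∀ U : ValuationSubring N, V ≤ U → U ≤ W' → U ≠ W' → ∃ r ∈ R, r ∉ U := by
      intro U hVU hUW' hUne
      obtain ⟨r, hr, hrU⟩ :=
        exists_mem_inter_not_mem W W' G' hG' hkey S hS (Finset.mem_image.mp hV) U hVU hUW' hUne
      refine ⟨r, (hR r).mpr ⟨hr.1, fun V' hV' hne' => ?_⟩, hrU⟩
      obtain ⟨σ', hσ', rfl⟩ := Finset.mem_image.mp hV'
      exact hr.2 σ' hσ' hne'
    have heW' : σV V • d / z⁻¹ ∈ W' := by
      rw [div_eq_mul_inv, inv_inv]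
      refine W'.mul_mem _ _ ?_ hzW'
      rw [← hG' (σV V) (hS _ (hσVS V hV)).1]
      exact ValuationSubring.smul_mem_pointwise_smul _ _ _ hd
    have he0 : σV V • d / z⁻¹ ≠ 0 := by
      refine div_ne_zero ?_ hπ0
      rw [AlgEquiv.smul_def]
      exact (_root_.map_ne_zero _).mpr hd0
    by_cases heV : σV V • d / z⁻¹ ∈ V
    · obtain ⟨x, hxR, hxV⟩ := hjoin V le_rfl (h𝓥W' V hV).1 (h𝓥W' V hV).2
      refine ⟨x, (hR x).mp hxR, hxV, fun h => hxV ?_⟩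
      have : x = x / (σV V • d / z⁻¹) * (σV V • d / z⁻¹) := by rw [div_mul_cancel₀ _ he0]
      rw [this]
      exact V.mul_mem _ _ h heV
    · obtain ⟨x, hxR, hxV, hxe⟩ :=
        exists_mem_not_mem_div_not_mem (h𝓥W' V hV).1 heW' heV R hjoin
      exact ⟨x, (hR x).mp hxR, hxV, hxe⟩
  choose! xs hxsR hxsV hxse using hlarge
  -- the element `x = π Σ_V x_V`
  refine ⟨z⁻¹ * ∑ V ∈ 𝓥, xs V, ?_, fun σ hσ => ?_⟩
  · rw [map_mul]
    calc W.valuation z⁻¹ * W.valuation (∑ V ∈ 𝓥, xs V) ≤ W.valuation z⁻¹ * 1 := by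
          gcongr
          exact (W.valuation_le_one_iff _).mpr (sum_mem fun V hV => (hxsR V hV).1)
      _ < 1 := by rw [mul_one]; exact hπW
  · have hV : σ • W ∈ 𝓥 := Finset.mem_image.mpr ⟨σ, hσ, rfl⟩
    set V := σ • W with hV_def
    -- `|x_V|_V > 1 ≥ |Σ_{V' ≠ V} x_{V'}|_V`, so `|Σ|_V = |x_V|_V`
    have hsum : V.valuation (∑ V' ∈ 𝓥, xs V') = V.valuation (xs V) := by
      rw [← Finset.add_sum_erase 𝓥 xs hV]
      refine Valuation.map_add_eq_of_lt_left (v := V.valuation) ?_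
      have h1 : V.valuation (∑ V' ∈ 𝓥.erase V, xs V') ≤ 1 := by
        refine (V.valuation_le_one_iff _).mpr (sum_mem fun V' hV' => ?_)
        obtain ⟨hne', hV'𝓥⟩ := Finset.mem_erase.mp hV'
        exact (hxsR V' hV'𝓥).2 V hV (Ne.symm hne')
      have h2 : 1 < V.valuation (xs V) :=
        lt_of_not_ge fun h => hxsV V hV ((V.valuation_le_one_iff _).mp h)
      exact lt_of_le_of_lt h1 h2
    -- `|x_V|_V > |σ_V d / π|_V ≥ |σ d|_V / |π|_V`
    have he0 : V.valuation (σV V • d / z⁻¹) ≠ 0 := by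
      refine (_root_.map_ne_zero _).mpr (div_ne_zero ?_ hπ0)
      rw [AlgEquiv.smul_def]
      exact (_root_.map_ne_zero _).mpr hd0
    have hev : V.valuation (σV V • d / z⁻¹) < V.valuation (xs V) := by
      have h1 : 1 < V.valuation (xs V / (σV V • d / z⁻¹)) :=
        lt_of_not_ge fun h => hxse V hV ((V.valuation_le_one_iff _).mp h)
      rwa [map_div₀, lt_div_iff₀ (zero_lt_iff.mpr he0), one_mul] at h1
    have key : V.valuation (σ • d) < V.valuation (z⁻¹ * ∑ V' ∈ 𝓥, xs V') := by
      calc V.valuation (σ • d) ≤ V.valuation (σV V • d) := hσVmax V hV σ hσ rfl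
        _ = V.valuation (σV V • d / z⁻¹) * V.valuation z⁻¹ := by
            rw [← map_mul, div_mul_cancel₀ _ hπ0]
        _ < V.valuation (xs V) * V.valuation z⁻¹ :=
            mul_lt_mul_of_pos_right hev (zero_lt_iff.mpr ((_root_.map_ne_zero _).mpr hπ0))
        _ = V.valuation (z⁻¹ * ∑ V' ∈ 𝓥, xs V') := by rw [map_mul, hsum, mul_comm]
    have := (smul_valuation_lt_iff σ W _ _).mp key
    rwa [inv_smul_smul] at this

end Galois

end Literature.AlgebraicGeometry.Resolution
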